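import Literature.NumberTheory.LFunctions.Zhang2022.KnifeEdgeLenLongLegChiWindow
import Literature.NumberTheory.LFunctions.Zhang2022.KnifeEdgeThreshold
import Literature.NumberTheory.LFunctions.Zhang2022.KnifeEdgeLenZDegreeShortPolyDense
import HarnessLib

/-!
# 𝒳₂ `LongPairsGradedTables` (stmt-Parity-20446): refuter battery on the DILATED companions (p564811 Part 4, p567123 Part 5)

Route `ZDegreeToeplitzBand`, crux 𝒳₂ = `LongPairsGradedTables` (HELD). The re-typed leg-split slots of
`Zhang2022/KnifeEdgeLenLongLegChiWindow.lean` — Leg A `KnifeEdge.LongLegSplit.FormulaILongPsiDil` (K2-Dil), Leg B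
`FormulaILongDualDil` (K1-Dil), Lemma 8.1 `Lemma81LongPsiDil` (P2-Dil), transfer shape `LegSplitTransferX2Dil` — are
bare `Prop`s asserted by no one. Two kernel facts for the referee's desk (LSR-541 battery, ls-ref-1 g10):

* **Irrefutability (Part 1).** Each of the four is an (A)-guarded eventual statement (the transfer through its
  consequent `∃ X₂, TauTwoTablePsi c′ X₂`), so a kernel `¬slot` exhibits Assumption (A) on real primitive characters
  beyond every `D₀` (`assumptionA_io_of_not_formulaILongPsiDil`, `…DualDil`, `…lemma81LongPsiDil`,
  `…legSplitTransferX2Dil`): none can be closed `refuted` short of the summit's own negation — exactly as for the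
  undilated slots (`LegSplitAmplitude.lean` Part 1, whose generic lemma is copied privately here so that this
  file imports no route-dependent Theorems module).
* **The corner cell sits inside the transfer's consequent and outside its Lemma-8.1 antecedent (Part 2).**
  `TauTwoTablePsi c′ X₂ = CrossTablePsi c′ 2 X₂` quantifies over ALL in-class pairs, in particular over Zhang's own
  full-length pieces `ϰ_{1,k}(y) = (1−y)e^{iπk(1−y)}` (`KnifeEdge.inClassPiece_kappaP_one`; `tauTwoTablePsi_corner`),
  while `Lemma81LongPsiDil` binds `ShortPiece θg g g′`, `ShortPiece θf f f′`, `θg + θf ≤ 2 − δ` with `δ > 0` fixed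
  before `ForAllLarge`: a `ϰ_{1,k}` piece is short of length `θ` iff `1 ≤ θ` (`shortPiece_kappaP_one_iff`), so for the
  pair `(ϰ_{1,k}, ϰ_{1,k′})` every admissible `(θf, θg)` has `θf + θg ≥ 2 > 2 − δ` (`not_lemma81Dil_regime_at_corner`):
  P2-Dil is silent on the corner `λ = 2` for EVERY `δ`, and the corner pair is a long pair (`not_shortPairs_corner`,
  so it lies in the `¬ShortPairs` classes of the degree-1 conjuncts of `LongPairsGradedTables` as well). READING: as
  typed, a proof of `LegSplitTransferX2Dil c′` must produce the degree-2 table at the corner from the two legs alone —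
  the boundary cell C5 that K1A-DISPLAY-6 v0.1 lists as UNEVALUATED; the letter booked for the transfer («bookkeeping
  M»: the `D^{−1/2}` repayment plus the counts) covers the non-corner long pairs only. Repairs that keep every kernel
  consumer: key the consequent (and 20446's third conjunct) on a pair class excluding `θf + θg = 2` (the tenure's class
  token), or add a corner clause / a K0-type continuity input as a fourth antecedent. Nothing here is false; the
  shape over-reaches its antecedents at one cell.

* **Rev 2 (Part 3) — the tenure's class token (route edit WAKE R2, h2′ `PsiGradedTablesClosePoly`: pairs whose pieces
  are EACH `θ < 1 ∧ PolyShortPiece θ`).** On such a pair `Lemma81LongPsiDil`'s binder triple is met with the POINTWISE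
  `δ := 2 − θ_g − θ_f > 0` (`lemma81Dil_regime_of_polyShort_lt_one`) — so keyed ON that class the transfer needs no corner
  engine; and it is the strict `θ < 1`, not polynomiality, that removes the corner: `ϰ_{1,0} = 1 − y` IS a polynomial
  short piece of length exactly `1` (`polyShortPiece_kappaP_one_zero`), while no `ϰ_{1,k}` is polynomial-short of any
  length `< 1` (`not_polyShortPiece_kappaP_one_of_lt_one`), whence the corner pair lies outside every class carrying the
  token (`not_mem_class_corner_of_polyShort_token`, h2′'s `h𝒞` hypothesis shape verbatim). Rev 2 also drops the unused
  import of the route file (this module is route-independent: Literature imports only).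

No definition is declared; standard axioms. «The programme SEARCHES and TYPES; no claim about Landau–Siegel
zeros, Theorems 1–2 of arXiv:2211.02515 or a repaired Margin232 until a kernel theorem says so.»

## References

* [Zhang2022LandauSiegel] Y. Zhang, Discrete mean estimates and the Landau–Siegel zero, arXiv:2211.02515v1
  (2022): §2 p. 4 (Assumption (A)), (2.23)–(2.25) p. 9 (the `ϰ` profiles), §7 Prop. 7.1, (7.2) p. 13,
  §8 Lemma 8.1, (8.5) p. 16, Lemma 3.3.
-/

noncomputable section

namespace Summit.Parity.GeneralizedHardyLittlewood.Theorems.LongPairsGradedTables.Negative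

open Complex Real ComplexConjugate Finset
open Literature.NumberTheory.LFunctions.Zhang2022
open Literature.NumberTheory.LFunctions.Zhang2022.Skeleton
open Literature.NumberTheory.LFunctions.Zhang2022.Repair
open Literature.NumberTheory.LFunctions.Zhang2022.KnifeEdge
open Literature.NumberTheory.LFunctions.Zhang2022.KnifeEdge.LongLegSplit

/-! ### Part 1 — irrefutability of the four dilated slots -/

/-- generic (local copy of `LegSplitAmplitude.assumptionA_io_of_not_forAllLarge_guarded`, kept private so that this
file does not build on a route-dependent module): the negation of an (A)-guarded eventual statement exhibits (A) beyond
every `D₀`. [cite: Zhang2022LandauSiegel, §2 p. 4 Assumption (A)] -/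
private theorem io_of_not_guarded {S : (D : ℕ) → [NeZero D] → DirichletCharacter ℂ D → Prop}
    (h : ¬ ForAllLarge fun D _ χ => AssumptionA D χ → S D χ) (D₀ : ℕ) :
    ∃ (D : ℕ) (_ : NeZero D) (χ : DirichletCharacter ℂ D),
      D₀ ≤ D ∧ χ.IsQuadratic ∧ χ.IsPrimitive ∧ AssumptionA D χ := by
  by_contra hc
  push Not at hc
  exact h ⟨D₀, fun D _ χ hD hq hp hA => (hc D ‹_› χ hD hq hp hA).elim⟩

/-- A kernel refutation of Leg A re-typed (`FormulaILongPsiDil`) exhibits (A) infinitely often.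
[cite: Zhang2022LandauSiegel, §2 p. 4, §7 Prop. 7.1] -/
theorem assumptionA_io_of_not_formulaILongPsiDil {c' : ℝ} (h : ¬ FormulaILongPsiDil c') (D₀ : ℕ) :
    ∃ (D : ℕ) (_ : NeZero D) (χ : DirichletCharacter ℂ D),
      D₀ ≤ D ∧ χ.IsQuadratic ∧ χ.IsPrimitive ∧ AssumptionA D χ := by
  unfold FormulaILongPsiDil at h
  push Not at h
  obtain ⟨B, ε, _, hC⟩ := h
  exact io_of_not_guarded (hC 0) D₀

/-- A kernel refutation of Leg B re-typed (`FormulaILongDualDil`) exhibits (A) infinitely often.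
[cite: Zhang2022LandauSiegel, §2 p. 4, §7 Prop. 7.1] -/
theorem assumptionA_io_of_not_formulaILongDualDil {c' : ℝ} (h : ¬ FormulaILongDualDil c') (D₀ : ℕ) :
    ∃ (D : ℕ) (_ : NeZero D) (χ : DirichletCharacter ℂ D),
      D₀ ≤ D ∧ χ.IsQuadratic ∧ χ.IsPrimitive ∧ AssumptionA D χ := by
  unfold FormulaILongDualDil at h
  push Not at h
  obtain ⟨B, ε, _, hC⟩ := h
  exact io_of_not_guarded (hC 0) D₀

/-- A kernel refutation of the re-typed extended Lemma 8.1 (`Lemma81LongPsiDil`) exhibits (A) infinitely often.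
[cite: Zhang2022LandauSiegel, §2 p. 4, §8 Lemma 8.1] -/
theorem assumptionA_io_of_not_lemma81LongPsiDil {c' : ℝ} (h : ¬ Lemma81LongPsiDil c') (D₀ : ℕ) :
    ∃ (D : ℕ) (_ : NeZero D) (χ : DirichletCharacter ℂ D),
      D₀ ≤ D ∧ χ.IsQuadratic ∧ χ.IsPrimitive ∧ AssumptionA D χ := by
  unfold Lemma81LongPsiDil at h
  push Not at h
  obtain ⟨δ, _, B, ε, _, hC⟩ := h
  exact io_of_not_guarded hC D₀

/-- A kernel refutation of the re-typed transfer shape (`LegSplitTransferX2Dil`) exhibits (A) infinitely often (it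
would refute the `X₂` table for EVERY functional, in particular `0`). [cite: Zhang2022LandauSiegel, §2 p. 4, §8 (8.5)] -/
theorem assumptionA_io_of_not_legSplitTransferX2Dil {c' : ℝ} (h : ¬ LegSplitTransferX2Dil c') (D₀ : ℕ) :
    ∃ (D : ℕ) (_ : NeZero D) (χ : DirichletCharacter ℂ D),
      D₀ ≤ D ∧ χ.IsQuadratic ∧ χ.IsPrimitive ∧ AssumptionA D χ := by
  unfold LegSplitTransferX2Dil at h
  push Not at h
  obtain ⟨_, _, _, hX⟩ := h
  have h0 := hX fun _ _ _ _ => 0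
  unfold TauTwoTablePsi CrossTablePsi at h0
  push Not at h0
  obtain ⟨_, _, _, _, _, _, ε, _, hC⟩ := h0
  exact io_of_not_guarded hC D₀

/-! ### Part 2 — the corner `λ = 2`: inside the transfer's consequent, outside `Lemma81LongPsiDil`'s binders -/

/-- Zhang's length-`P` piece `ϰ_{1,k}` does not vanish before the wall: `ϰ_{1,k}(y) ≠ 0` for `y < 1`.
[cite: Zhang2022LandauSiegel, (2.23)–(2.25) p. 9] -/
theorem kappaP_one_ne_zero (k : ℝ) {y : ℝ} (hy : y < 1) : kappaP 1 k y ≠ 0 := by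
  rw [kappaP_of_le hy.le]
  refine mul_ne_zero ?_ (Complex.exp_ne_zero _)
  have : (1 - y / 1 : ℝ) ≠ 0 := by rw [div_one]; exact sub_ne_zero.mpr (ne_of_gt hy)
  exact_mod_cast this

/-- **`ϰ_{1,k}` is a short piece of length `θ` iff `1 ≤ θ`** — its minimal log-length is the full length `1`.
[cite: Zhang2022LandauSiegel, (2.23)–(2.25) p. 9; §7 (7.2) p. 13] -/
theorem shortPiece_kappaP_one_iff (k θ : ℝ) : ShortPiece θ (kappaP 1 k) (kappaP' 1 k) ↔ 1 ≤ θ := by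
  constructor
  · intro h
    by_contra hθ
    exact kappaP_one_ne_zero k (lt_of_not_ge hθ) (h.vanish θ le_rfl)
  · intro hθ
    exact (inClassPiece_kappaP_one k).shortPiece_one.mono hθ

/-- **`Lemma81LongPsiDil`'s length regime misses the corner pair for every `δ > 0`:** whatever short-piece lengths
`θf, θg` are assigned to `(ϰ_{1,k}, ϰ_{1,k′})`, `θg + θf ≤ 2 − δ` fails. [cite: Zhang2022LandauSiegel, §8 Lemma 8.1 p. 16, Lemma 3.3] -/
theorem not_lemma81Dil_regime_at_corner {δ θf θg : ℝ} (hδ : 0 < δ) (k k' : ℝ)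
    (hf : ShortPiece θf (kappaP 1 k) (kappaP' 1 k)) (hg : ShortPiece θg (kappaP 1 k') (kappaP' 1 k')) :
    ¬ θg + θf ≤ 2 - δ := by
  have h1 := (shortPiece_kappaP_one_iff k θf).mp hf
  have h2 := (shortPiece_kappaP_one_iff k' θg).mp hg
  intro h; linarith

/-- **The corner pair is a LONG pair** (not in `ShortPairs`), hence inside the `¬ShortPairs` classes of the degree-1
conjuncts of `LongPairsGradedTables` too. [cite: Zhang2022LandauSiegel, §7 (7.2) p. 13] -/
theorem not_shortPairs_corner (k k' : ℝ) : ¬ ShortPairs (kappaP 1 k) (kappaP' 1 k) (kappaP 1 k') (kappaP' 1 k') := by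
  rintro ⟨θf, θg, hs, hf, hg⟩
  have h1 := (shortPiece_kappaP_one_iff k θf).mp hf
  have h2 := (shortPiece_kappaP_one_iff k' θg).mp hg
  linarith

/-- **The transfer's consequent DEMANDS the corner cell:** `TauTwoTablePsi c′ X₂` instantiated at `(ϰ_{1,k}, ϰ_{1,k′})`
is the (A)-guarded degree-2 asymptotic for Zhang's own full-length pair. [cite: Zhang2022LandauSiegel, §8 (8.5) p. 16] -/
theorem tauTwoTablePsi_corner {c' : ℝ} {X₂ : PairFunctional} (h : TauTwoTablePsi c' X₂) (k k' : ℝ)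
    (ε : ℝ) (hε : 0 < ε) :
    ForAllLarge fun D _ χ => AssumptionA D χ →
      ‖zDegMeanPsi c' χ 2 (fun x t => conj (KnifeEdge.profPoly χ x (kappaP 1 k') (⌊bigP D⌋₊ + 1) t))
            (fun x t => KnifeEdge.profPoly χ x (kappaP 1 k) (⌊bigP D⌋₊ + 1) t)
          - X₂ (kappaP 1 k) (kappaP' 1 k) (kappaP 1 k') (kappaP' 1 k') * frakA χ * frakP D‖
        ≤ ε * frakA χ * frakP D :=
  h _ _ _ _ (inClassPiece_kappaP_one k) (inClassPiece_kappaP_one k') ε hε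

/-- … while every instance of `Lemma81LongPsiDil c′` at that pair is VACUOUS: its length hypothesis is unsatisfiable,
so the slot yields no statement about `lhs81Ext` of the corner datum (the consequent `Q` below is arbitrary).
[cite: Zhang2022LandauSiegel, §8 Lemma 8.1 p. 16] -/
theorem lemma81Dil_corner_instance_vacuous {δ θf θg : ℝ} (hδ : 0 < δ) (k k' : ℝ) (Q : Prop)
    (hf : ShortPiece θf (kappaP 1 k) (kappaP' 1 k)) (hg : ShortPiece θg (kappaP 1 k') (kappaP' 1 k')) :
    θg + θf ≤ 2 - δ → Q :=
  fun h => absurd h (not_lemma81Dil_regime_at_corner hδ k k' hf hg)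

/-! ### Part 3 (rev 2) — the class token `θ < 1 ∧ PolyShortPiece θ` per piece: P2-Dil's regime is met pointwise on it,
and the corner is exactly what the strict `θ < 1` removes -/

/-- **On a pair whose pieces are each polynomial-short of length `< 1`, `Lemma81LongPsiDil`'s binder triple
`ShortPiece θg g g'`, `ShortPiece θf f f'`, `θg + θf ≤ 2 − δ` is satisfiable with the POINTWISE `δ := 2 − θ_g − θ_f > 0`**
(no uniform `δ`, no class constant): keyed ON the tenure's class the transfer meets P2-Dil's regime at every pair.
[cite: Zhang2022LandauSiegel, §8 Lemma 8.1 p. 16; §7 (7.2) p. 13] -/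
theorem lemma81Dil_regime_of_polyShort_lt_one {f f' g g' : ℝ → ℂ}
    (hf : ∃ θ : ℝ, θ < 1 ∧ PolyShortPiece θ f f') (hg : ∃ θ : ℝ, θ < 1 ∧ PolyShortPiece θ g g') :
    ∃ δ θg θf : ℝ, 0 < δ ∧ ShortPiece θg g g' ∧ ShortPiece θf f f' ∧ θg + θf ≤ 2 - δ := by
  obtain ⟨θf, hθf, hF⟩ := hf
  obtain ⟨θg, hθg, hG⟩ := hg
  exact ⟨2 - θg - θf, θg, θf, by linarith, hG.shortPiece, hF.shortPiece, by linarith⟩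

/-- **`ϰ_{1,0}(y) = 1 − y` on `(−∞,1]`, `0` beyond, IS a POLYNOMIAL short piece of length exactly `1`** (polynomial
`1 − X`, vanishing at the kink): the polynomial class at `θ = 1` still contains a corner piece.
[cite: Zhang2022LandauSiegel, (2.23)–(2.25) p. 9; §7 (7.2) p. 13] -/
theorem polyShortPiece_kappaP_one_zero : PolyShortPiece 1 (kappaP 1 0) (kappaP' 1 0) := by
  refine ⟨le_rfl, 1 - Polynomial.X, by simp, ?_, ?_⟩
  · funext y
    by_cases hy : y < 1
    · rw [polyPiece_of_lt hy, kappaP_of_le hy.le]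
      simp [div_one]
    · rw [polyPiece_of_le (not_lt.mp hy), kappaP_of_ge one_ne_zero (not_lt.mp hy)]
  · funext y
    by_cases hy : y < 1
    · rw [polyPieceDeriv_of_lt hy, kappaP'_of_lt hy]
      simp
    · rw [polyPieceDeriv_of_le (not_lt.mp hy), kappaP'_of_ge (not_lt.mp hy)]

/-- **No `ϰ_{1,k}` piece is polynomial-short of a length `< 1`** (it does not even vanish before the wall,
`shortPiece_kappaP_one_iff`). [cite: Zhang2022LandauSiegel, (2.23)–(2.25) p. 9; §7 (7.2) p. 13] -/
theorem not_polyShortPiece_kappaP_one_of_lt_one {θ : ℝ} (hθ : θ < 1) (k : ℝ) :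
    ¬ PolyShortPiece θ (kappaP 1 k) (kappaP' 1 k) := fun h =>
  absurd ((shortPiece_kappaP_one_iff k θ).mp h.shortPiece) (not_le.mpr hθ)

/-- **The corner pair lies outside every pair class carrying the token** — hypothesis `h𝒞` is the class condition of
h2′ `PsiGradedTablesClosePoly` verbatim (`∀ f f' g g', 𝒞 f f' g g' → (∃ θ, θ < 1 ∧ PolyShortPiece θ f f') ∧ (∃ θ, θ < 1 ∧
PolyShortPiece θ g g')`): a `ϰ_{1,k}` piece on either side excludes the pair from `𝒞`.
[cite: Zhang2022LandauSiegel, (2.23)–(2.25) p. 9; §7 (7.2) p. 13; §8 (8.5) p. 16] -/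
theorem not_mem_class_corner_of_polyShort_token {𝒞 : PairClass}
    (h𝒞 : ∀ f f' g g', 𝒞 f f' g g' →
      (∃ θ : ℝ, θ < 1 ∧ PolyShortPiece θ f f') ∧ (∃ θ : ℝ, θ < 1 ∧ PolyShortPiece θ g g'))
    (k : ℝ) (g g' : ℝ → ℂ) :
    ¬ 𝒞 (kappaP 1 k) (kappaP' 1 k) g g' ∧ ¬ 𝒞 g g' (kappaP 1 k) (kappaP' 1 k) := by
  refine ⟨fun h => ?_, fun h => ?_⟩
  · obtain ⟨⟨θ, hθ, hP⟩, -⟩ := h𝒞 _ _ _ _ h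
    exact not_polyShortPiece_kappaP_one_of_lt_one hθ k hP
  · obtain ⟨-, ⟨θ, hθ, hP⟩⟩ := h𝒞 _ _ _ _ h
    exact not_polyShortPiece_kappaP_one_of_lt_one hθ k hP

end Summit.Parity.GeneralizedHardyLittlewood.Theorems.LongPairsGradedTables.Negative

end
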